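/- Free-seat work of WIDTH SEAT `ym-line-cbag-p1-w2` (prover-ym-line-cbag-p1-w2-g18-0), route `EguchiKawaiDirectionLadder`
(ideator ym-idea-2, LINE 8), crux `TripleSmallBallMargin` (stmt-QuantumFields-27724), v7 last mile, step (3) of the LEAD's
FILE A: the Haar bound of the OFF-BLOCK EVENT with the exponent written as the INCREASING labelled cross-pair count `X'(ℓ)` of a
total labelling `ℓ : Fin N → Fin (m+1)` (collar = `Fin.last m`) — the count that `BlockRelabel.blocks_from_pair_profile_fin`
(iv) bounds from below — and the squared form for the pair event `offBlockEvent ×ˢ offBlockEvent`.  Pure bookkeeping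
(the random-matrix input is width seat w3's off-diagonal-block small ball, already behind `haar_offBlockEvent_le`).
ROUTE-INDEPENDENT.  The route bears on the barrier-ledger fact `EguchiKawaiBreakdown`; the Yang–Mills mass gap is NOT
proved by anything here. -/
import Summits.QuantumFields.YangMills.Theorems.EguchiKawaiDirectionLadderOffBlockEvent
import Summits.QuantumFields.YangMills.Theorems.EguchiKawaiDirectionLadderBlockRelabel
import HarnessLib

/-!
# Route `EguchiKawaiDirectionLadder`, crux `TripleSmallBallMargin`: off-block event — cross-pair-count exponent

Throughout `X'(ℓ) = #{(j,k) : j < k, ℓ j ≠ ℓ k, ℓ j ≠ last, ℓ k ≠ last}` (increasing labelled cross pairs) and `s = m·m·b/N`.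

* `finSuccEquivLast_symm_toOptionLabel` — `finSuccEquivLast.symm (toOptionLabel ℓ i) = ℓ i` (the two label dictionaries agree);
* `labelPairCount_toOptionLabel` — `labelPairCount (toOptionLabel ℓ) = 2 · X'(ℓ)`;
* `haar_offBlockEvent_le_pow_crossPairs` — `Haar(offBlockEvent ℓ b) ≤ exp(C_m N²) · s^{X'(ℓ)}` for `0 < s ≤ 1`;
* `haar_offBlockEvent_le_rpow_of_le` — `… ≤ exp(C_m N²) · s^x` for every real `0 ≤ x ≤ X'(ℓ)`;
* `haarPair_offBlockEvent_prod_le_rpow_of_le` — `(Haar ⊗ Haar)(offBlockEvent ℓ b ×ˢ offBlockEvent ℓ b) ≤ exp(2 C_m N²) · s^{2x}`.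
-/

set_option autoImplicit false

noncomputable section

open Finset MeasureTheory
open scoped ENNReal
open Literature.Barriers.QuantumFields
open Literature.MathematicalPhysics.QuantumFieldTheory (haarProbability)

namespace Summit.QuantumFields.YangMills.Theorems.EguchiKawaiDirectionLadder

variable {N m : ℕ}

/-- The two label dictionaries agree: `finSuccEquivLast.symm (toOptionLabel ℓ i) = ℓ i`. -/
theorem finSuccEquivLast_symm_toOptionLabel (ℓ : Fin N → Fin (m + 1)) (i : Fin N) :
    finSuccEquivLast.symm (toOptionLabel ℓ i) = ℓ i := by
  by_cases h : ℓ i = Fin.last m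
  · rw [(toOptionLabel_eq_none_iff ℓ i).2 h, finSuccEquivLast_symm_none, h]
  · have h' : toOptionLabel ℓ i = some ((ℓ i).castPred h) :=
      (toOptionLabel_eq_some_iff ℓ i _).2 (Fin.castSucc_castPred _ h).symm
    rw [h', finSuccEquivLast_symm_some, Fin.castSucc_castPred]

/-- `labelPairCount (toOptionLabel ℓ) = 2 · X'(ℓ)` with `X'(ℓ)` the increasing labelled cross-pair count of `ℓ` itself. -/
theorem labelPairCount_toOptionLabel (ℓ : Fin N → Fin (m + 1)) :
    labelPairCount (toOptionLabel ℓ) =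
      2 * ((univ : Finset (Fin N × Fin N)).filter
        (fun p => p.1 < p.2 ∧ ℓ p.1 ≠ ℓ p.2 ∧ ℓ p.1 ≠ Fin.last m ∧ ℓ p.2 ≠ Fin.last m)).card := by
  rw [BlockRelabel.labelPairCount_eq_two_mul_crossPairs]
  simp only [finSuccEquivLast_symm_toOptionLabel]

/-- **Off-block event, cross-pair-count exponent**: for every `m` there is `C_m ≥ 0` with
`Haar(offBlockEvent ℓ b) ≤ exp(C_m N²) · (m·m·b/N)^{X'(ℓ)}` for all `N > 0`, `ℓ : Fin N → Fin (m+1)`, `b ≥ 0` with `0 < m·m·b/N ≤ 1`. -/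
theorem haar_offBlockEvent_le_pow_crossPairs (m : ℕ) :
    ∃ Cm : ℝ, 0 ≤ Cm ∧ ∀ (N : ℕ) (ℓ : Fin N → Fin (m + 1)) (b : ℝ), 0 ≤ b → 0 < N →
      0 < (m : ℝ) * m * b / N → (m : ℝ) * m * b / N ≤ 1 →
        haarProbability (UN N) (offBlockEvent ℓ b) ≤
          ENNReal.ofReal (Real.exp (Cm * (N : ℝ) ^ 2) *
            ((m : ℝ) * m * b / N) ^ ((univ : Finset (Fin N × Fin N)).filter
              (fun p => p.1 < p.2 ∧ ℓ p.1 ≠ ℓ p.2 ∧ ℓ p.1 ≠ Fin.last m ∧ ℓ p.2 ≠ Fin.last m)).card) := by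
  obtain ⟨Cm, hCm, h⟩ := haar_offBlockEvent_le m
  refine ⟨Cm, hCm, fun N ℓ b hb hN hs hs1 => ?_⟩
  have h' := h N ℓ b hb hN hs hs1
  have hexp : ((labelPairCount (toOptionLabel ℓ) : ℕ) : ℝ) / 2 =
      ((((univ : Finset (Fin N × Fin N)).filter
        (fun p => p.1 < p.2 ∧ ℓ p.1 ≠ ℓ p.2 ∧ ℓ p.1 ≠ Fin.last m ∧ ℓ p.2 ≠ Fin.last m)).card : ℕ) : ℝ) := by
    rw [labelPairCount_toOptionLabel]; push_cast; ring
  rw [hexp, Real.rpow_natCast] at h'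
  exact h'

/-- **Off-block event, real exponent below the cross-pair count**: with `s = m·m·b/N ∈ (0,1]` and any real `0 ≤ x ≤ X'(ℓ)`,
`Haar(offBlockEvent ℓ b) ≤ exp(C_m N²) · s^x` (since `s^{X'} ≤ s^x` for `s ≤ 1`). -/
theorem haar_offBlockEvent_le_rpow_of_le (m : ℕ) :
    ∃ Cm : ℝ, 0 ≤ Cm ∧ ∀ (N : ℕ) (ℓ : Fin N → Fin (m + 1)) (b x : ℝ), 0 ≤ b → 0 < N →
      0 < (m : ℝ) * m * b / N → (m : ℝ) * m * b / N ≤ 1 → 0 ≤ x →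
        x ≤ (((univ : Finset (Fin N × Fin N)).filter
              (fun p => p.1 < p.2 ∧ ℓ p.1 ≠ ℓ p.2 ∧ ℓ p.1 ≠ Fin.last m ∧ ℓ p.2 ≠ Fin.last m)).card : ℝ) →
        haarProbability (UN N) (offBlockEvent ℓ b) ≤
          ENNReal.ofReal (Real.exp (Cm * (N : ℝ) ^ 2) * ((m : ℝ) * m * b / N) ^ x) := by
  obtain ⟨Cm, hCm, h⟩ := haar_offBlockEvent_le_pow_crossPairs m
  refine ⟨Cm, hCm, fun N ℓ b x hb hN hs hs1 hx0 hx => ?_⟩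
  refine (h N ℓ b hb hN hs hs1).trans (ENNReal.ofReal_le_ofReal ?_)
  refine mul_le_mul_of_nonneg_left ?_ (Real.exp_pos _).le
  rw [← Real.rpow_natCast]
  exact Real.rpow_le_rpow_of_exponent_ge hs hs1 hx

/-- **The pair off-block event**: with `s = m·m·b/N ∈ (0,1]` and any real `0 ≤ x ≤ X'(ℓ)`,
`(Haar ⊗ Haar)(offBlockEvent ℓ b ×ˢ offBlockEvent ℓ b) ≤ exp(2·C_m·N²) · s^{2x}`. -/
theorem haarPair_offBlockEvent_prod_le_rpow_of_le (m : ℕ) :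
    ∃ Cm : ℝ, 0 ≤ Cm ∧ ∀ (N : ℕ) (ℓ : Fin N → Fin (m + 1)) (b x : ℝ), 0 ≤ b → 0 < N →
      0 < (m : ℝ) * m * b / N → (m : ℝ) * m * b / N ≤ 1 → 0 ≤ x →
        x ≤ (((univ : Finset (Fin N × Fin N)).filter
              (fun p => p.1 < p.2 ∧ ℓ p.1 ≠ ℓ p.2 ∧ ℓ p.1 ≠ Fin.last m ∧ ℓ p.2 ≠ Fin.last m)).card : ℝ) →
        ((haarProbability (UN N)).prod (haarProbability (UN N))) (offBlockEvent ℓ b ×ˢ offBlockEvent ℓ b) ≤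
          ENNReal.ofReal (Real.exp (2 * Cm * (N : ℝ) ^ 2) * ((m : ℝ) * m * b / N) ^ (2 * x)) := by
  obtain ⟨Cm, hCm, h⟩ := haar_offBlockEvent_le_rpow_of_le m
  refine ⟨Cm, hCm, fun N ℓ b x hb hN hs hs1 hx0 hx => ?_⟩
  have h1 := h N ℓ b x hb hN hs hs1 hx0 hx
  set s : ℝ := (m : ℝ) * m * b / N with hs_def
  have hnn : 0 ≤ Real.exp (Cm * (N : ℝ) ^ 2) * s ^ x := by positivity
  rw [Measure.prod_prod]
  calc haarProbability (UN N) (offBlockEvent ℓ b) * haarProbability (UN N) (offBlockEvent ℓ b)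
      ≤ ENNReal.ofReal (Real.exp (Cm * (N : ℝ) ^ 2) * s ^ x) *
          ENNReal.ofReal (Real.exp (Cm * (N : ℝ) ^ 2) * s ^ x) := mul_le_mul' h1 h1
    _ = ENNReal.ofReal (Real.exp (2 * Cm * (N : ℝ) ^ 2) * s ^ (2 * x)) := by
        rw [← ENNReal.ofReal_mul hnn]
        congr 1
        have hexp : Real.exp (2 * Cm * (N : ℝ) ^ 2) = Real.exp (Cm * (N : ℝ) ^ 2) * Real.exp (Cm * (N : ℝ) ^ 2) := by
          rw [← Real.exp_add]; ring_nf
        have hpow : s ^ (2 * x) = s ^ x * s ^ x := by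
          rw [two_mul, Real.rpow_add hs]
        rw [hexp, hpow]; ring

end Summit.QuantumFields.YangMills.Theorems.EguchiKawaiDirectionLadder

end
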